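/-
Origin: expansion seat `planner-pub-hodgecm-pv10-g5-0`, handover #6(6/6) 2026-08-18T15:21:38Z ; rewrite: ^import Pv10g5\.HolomorphicDeck -> import HodgeCM.PerL34.HolomorphicDeck ; ^import Pv10g5\.BallHolomorphic -> import HodgeCM.PerL34.BallHolomorphic (`HOME/pub-hodgecm-pv10-g5/lean/Pv10g5/BallGaloisCovering.lean`, md5 d0c7894c, 263 lines);
landed by the gen-8 packager in gate run 31 as `HodgeCM/PerL34/BallGaloisCovering.lean` (import ^import Pv10g5\.BallHolomorphic[ \t]*$→import HodgeCM.PerL34.BallHolomorphic ×1; import ^import Pv10g5\.HolomorphicDeck[ \t]*$→import HodgeCM.PerL34.HolomorphicDeck ×1; stripped 4 #print/#check/#eval lines).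
-/
/-
Origin: pub-hodgecm speedrun cell, seat pv10-g5 (DAG-NODE PROVER #10, gen 5), 2026-08-18.  STAGING for the tree import
(LEAN-IN-TREE RULE 2026-08-18): tree-shaped (≤ 400 lines, docstring on every decl); proposed tree home = with the PerL
ball-piece files (`BallQuotientManifold` §PerL, `BallCovering`) under `Summits/HodgeConjecture/PerL/…` (see
`HOME/pub-hodgecm-pv10-g5/MODULE-MAP-pv10.md`).
Target path: `HodgeCM/PerL34/BallGaloisCovering.lean`.
WIP imports `Pv10g5.HolomorphicDeck` ↦ `HodgeCM.PerL34.HolomorphicDeck` and `Pv10g5.BallHolomorphic` ↦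
`HodgeCM.PerL34.BallHolomorphic` at landing (TWO rewrites).  KERNEL, nothing cited, nothing posited.
-/
import Summits.HodgeConjecture.HodgeCM.PerL34.HolomorphicDeck
import Summits.HodgeConjecture.HodgeCM.PerL34.BallHolomorphic

/-!
# `P^L_{Γ_1} → P^L_Γ` is a finite GALOIS holomorphic covering

PerL v5 §1.2 ll. 72–75: *"for torsion-free `Γ`, `P^L_Γ := Γ\𝔹²` is a smooth projective surface, and there is a
neat normal `K_1 ⊂ K_f` of finite index with `P^L_{Γ_1} → P^L_Γ` finite étale"*.  On top of the general `C^n` deck /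
stages theory (`HolomorphicDeck`), the complex structure on `Γ\𝔹²` (`BallQuotientManifold`), the holomorphic étale
maps (`BallHolomorphic`) and pv10-g4's coverings (`BallCovering`), this file proves the complex-analytic GALOIS
structure of the tower:

* on `𝔹²` (ns `HodgeCM.PerL34.BallComplex`): every `γ ∈ U(2,1)` acts by a biholomorphism (`contMDiff_smul_ball`,
  `moebiusDiffeomorph`); for discrete free `Γ₁ ⊴ Γ ≤ U(2,1)` the deck transformations are biholomorphisms of the
  complex surface `Γ₁\𝔹²` (`ballDeckDiffeomorph`) and, for finite index and `Γ` discrete free,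
  `(Γ₁\𝔹²)/D ≃ₘ^ω Γ\𝔹²` (`ballStagesDiffeomorph`); the Prop-valued record `IsHolGalois` (deck maps holomorphic,
  `D` free, `Nat.card D = [Γ:Γ₁]`, `[[z]] ↦ [z]` a biholomorphism) holds (`isHolGalois`);
* PerL pieces (ns `HodgeCM.PerL34.ArchCompactK`, frame `hT`): `isHolGalois_ballOrbitMap`; for the small level
  `K₁ ⊴ K_f` of `Godement.exists_torsionFree_normal_tower`, EVERY piece `b` satisfies the Galois ball-piece record
  `BallPieceGalois` (pv10-g4's `BallPieceCovering` ∧ normal of finite index ∧ `IsHolEtale` ∧ `IsHolGalois` ∧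
  `[Γ':Γ₁'] = [Γ:Γ₁]`): **`HermSpace3.exists_ballPieces_galoisCovering`** — "`P^L_{Γ_1} → P^L_Γ` is a finite étale
  GALOIS covering with group `Γ/Γ_1`, and `P^L_Γ = (Γ/Γ_1) \ P^L_{Γ_1}`" in the complex-analytic category.

NOT claimed: algebraicity / projectivity of `Γ\𝔹²` (PRINT: Baily–Borel / Kodaira), étaleness in the scheme sense,
equality of the degree with `[K_f:K_1]` (only `[Γ:Γ₁] ∣ [K_f:K₁]`).
`#print axioms` of the headline results = `[propext, Classical.choice, Quot.sound]`.
-/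

open scoped Matrix Pointwise Manifold ContDiff Topology
open MulAction Set

/-! ## §4  The ball: Möbius maps, deck transformations and quotient in stages are biholomorphic -/

namespace HodgeCM.PerL34.BallComplex

open HodgeCM.PerL34.BallModel (U21 Ball x₀)
open HodgeCM.PerL34.QuotientManifold HodgeCM.PerL34.Godement.Stages

/-- **Möbius transformations `γ ∈ U(2,1)` are holomorphic self-maps of `𝔹²`.** -/
theorem contMDiff_smul_ball (γ : U21) : ContMDiff 𝓘(ℂ, Fin 2 → ℂ) 𝓘(ℂ, Fin 2 → ℂ) ω (fun z : Ball => γ • z) :=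
  contMDiff_smul_of_actsBy (actsBy_ball (⊤ : Subgroup U21)) ⟨γ, Subgroup.mem_top γ⟩

/-- The Möbius transformation `γ` as a BIHOLOMORPHISM of `𝔹²`. -/
noncomputable def moebiusDiffeomorph (γ : U21) : Ball ≃ₘ^ω⟮𝓘(ℂ, Fin 2 → ℂ), 𝓘(ℂ, Fin 2 → ℂ)⟯ Ball where
  toEquiv := MulAction.toPerm γ
  contMDiff_toFun := contMDiff_smul_ball γ
  contMDiff_invFun := by
    change ContMDiff 𝓘(ℂ, Fin 2 → ℂ) 𝓘(ℂ, Fin 2 → ℂ) ω (fun z : Ball => γ⁻¹ • z)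
    exact contMDiff_smul_ball γ⁻¹

/-- `moebiusDiffeomorph γ` is the action `z ↦ γ • z` as a map. -/
@[simp] theorem moebiusDiffeomorph_apply (γ : U21) (z : Ball) : moebiusDiffeomorph γ z = γ • z := rfl

variable (Γ₁ Γ : Subgroup U21) [DiscreteTopology Γ₁] [IsCancelSMul Γ₁ Ball]

/-- **Deck transformations of `Γ₁\𝔹²` are biholomorphic**: for `Γ₁ ⊴ Γ ≤ U(2,1)` (`Γ₁` discrete and free) and
`γ ∈ Γ`, `[z] ↦ [γ • z]` is a biholomorphism of the complex surface `Γ₁\𝔹²` (`isManifold_ballQuotient`). -/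
noncomputable def ballDeckDiffeomorph (hle : Γ₁ ≤ Γ) [(Γ₁.subgroupOf Γ).Normal] (γ : Γ) :
    orbitRel.Quotient Γ₁ Ball ≃ₘ^ω⟮𝓘(ℂ, Fin 2 → ℂ), 𝓘(ℂ, Fin 2 → ℂ)⟯ orbitRel.Quotient Γ₁ Ball :=
  deckDiffeomorph (actsBy_ball Γ) hle γ

/-- `ballDeckDiffeomorph Γ₁ Γ hle γ` is the deck transformation `deckHom Γ₁ Γ hle γ` as a map. -/
@[simp] theorem ballDeckDiffeomorph_apply (hle : Γ₁ ≤ Γ) [(Γ₁.subgroupOf Γ).Normal] (γ : Γ)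
    (q : orbitRel.Quotient Γ₁ Ball) : ballDeckDiffeomorph Γ₁ Γ hle γ q = deckHom Γ₁ Γ hle (X := Ball) γ q := rfl

/-- `ballDeckDiffeomorph Γ₁ Γ hle γ` sends the orbit `[z]` to `[γ • z]`. -/
theorem ballDeckDiffeomorph_mk (hle : Γ₁ ≤ Γ) [(Γ₁.subgroupOf Γ).Normal] (γ : Γ) (z : Ball) :
    ballDeckDiffeomorph Γ₁ Γ hle γ (Quotient.mk (orbitRel Γ₁ Ball) z) =
      Quotient.mk (orbitRel Γ₁ Ball) ((γ : U21) • z) := rfl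

/-- Deck transformations of `Γ₁\𝔹²` (discrete free `Γ₁ ⊴ Γ ≤ U(2,1)`) are holomorphic. -/
theorem contMDiff_ballDeckHom (hle : Γ₁ ≤ Γ) [(Γ₁.subgroupOf Γ).Normal] (γ : Γ) :
    ContMDiff 𝓘(ℂ, Fin 2 → ℂ) 𝓘(ℂ, Fin 2 → ℂ) ω (deckHom Γ₁ Γ hle (X := Ball) γ) :=
  contMDiff_deckHom (actsBy_ball Γ) hle γ

variable [DiscreteTopology Γ] [IsCancelSMul Γ Ball]

/-- **Quotient in stages on the ball, biholomorphically: `(Γ₁\𝔹²)/D ≃ₘ Γ\𝔹²`** for discrete free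
`Γ₁ ⊴ Γ ≤ U(2,1)` of finite index, `D ≅ Γ/Γ₁` the deck group. -/
noncomputable def ballStagesDiffeomorph (hle : Γ₁ ≤ Γ) [(Γ₁.subgroupOf Γ).Normal] [(Γ₁.subgroupOf Γ).FiniteIndex] :
    haveI := properlyDiscontinuousSMul_range_deckHom (M := Ball) hle
    haveI := isCancelSMul_range_deckHom (X := Ball) hle (stabilizer_inf_eq_bot_of_isCancelSMul Γ)
    haveI := locallyCompactSpace_orbitRelQuotient (Γ₁ := Γ₁) (M := Ball)
    orbitRel.Quotient (deckHom Γ₁ Γ hle (X := Ball)).range (orbitRel.Quotient Γ₁ Ball)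
      ≃ₘ^ω⟮𝓘(ℂ, Fin 2 → ℂ), 𝓘(ℂ, Fin 2 → ℂ)⟯ orbitRel.Quotient Γ Ball :=
  stagesDiffeomorph (actsBy_ball Γ) hle (stabilizer_inf_eq_bot_of_isCancelSMul Γ)

/-- **GALOIS DATA of the holomorphic covering `Γ₁\𝔹² → Γ\𝔹²`** (`Γ₁ ⊴ Γ ≤ U(2,1)` discrete, free, of finite
index; instance facts are ARGUMENTS so that the predicate can be used under binders): every deck transformation
`deckHom γ` is holomorphic (hence biholomorphic, its inverse being `deckHom γ⁻¹`); the deck group `D` acts FREELY on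
`Γ₁\𝔹²`; `|D| = [Γ : Γ₁]`; and pv10-g4's `stagesHomeomorph : (Γ₁\𝔹²)/D ≃ₜ Γ\𝔹²`, which sends `[[z]]` to `[z]`,
is holomorphic with holomorphic inverse. -/
def IsHolGalois (Γ₁ Γ : Subgroup U21) (d₁ : DiscreteTopology Γ₁) (c₁ : IsCancelSMul Γ₁ Ball)
    (d : DiscreteTopology Γ) (c : IsCancelSMul Γ Ball) (hle : Γ₁ ≤ Γ) (hN : (Γ₁.subgroupOf Γ).Normal)
    (hFI : (Γ₁.subgroupOf Γ).FiniteIndex) : Prop :=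
  haveI := d₁; haveI := c₁; haveI := d; haveI := c; haveI := hN; haveI := hFI
  haveI := properlyDiscontinuousSMul_range_deckHom (M := Ball) hle
  haveI := isCancelSMul_range_deckHom (X := Ball) hle (stabilizer_inf_eq_bot_of_isCancelSMul Γ)
  haveI := locallyCompactSpace_orbitRelQuotient (Γ₁ := Γ₁) (M := Ball)
  (∀ γ : Γ, ContMDiff 𝓘(ℂ, Fin 2 → ℂ) 𝓘(ℂ, Fin 2 → ℂ) ω (deckHom Γ₁ Γ hle (X := Ball) γ)) ∧
  (∀ q : orbitRel.Quotient Γ₁ Ball, stabilizer (deckHom Γ₁ Γ hle (X := Ball)).range q = ⊥) ∧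
  Nat.card (deckHom Γ₁ Γ hle (X := Ball)).range = Γ₁.relIndex Γ ∧
  (∀ z : Ball, stagesHomeomorph Γ₁ Γ hle (X := Ball)
      (Quotient.mk (orbitRel _ (orbitRel.Quotient Γ₁ Ball)) (Quotient.mk (orbitRel Γ₁ Ball) z)) =
    Quotient.mk (orbitRel Γ Ball) z) ∧
  ContMDiff 𝓘(ℂ, Fin 2 → ℂ) 𝓘(ℂ, Fin 2 → ℂ) ω (stagesHomeomorph Γ₁ Γ hle (X := Ball)) ∧
  ContMDiff 𝓘(ℂ, Fin 2 → ℂ) 𝓘(ℂ, Fin 2 → ℂ) ω (stagesHomeomorph Γ₁ Γ hle (X := Ball)).symm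

/-- Discrete free `Γ₁ ⊴ Γ ≤ U(2,1)` of finite index: the Galois data `IsHolGalois` hold. -/
theorem isHolGalois (hle : Γ₁ ≤ Γ) [hN : (Γ₁.subgroupOf Γ).Normal] [hFI : (Γ₁.subgroupOf Γ).FiniteIndex] :
    IsHolGalois Γ₁ Γ ‹_› ‹_› ‹_› ‹_› hle hN hFI := by
  have hfree := stabilizer_inf_eq_bot_of_isCancelSMul Γ
  haveI := properlyDiscontinuousSMul_range_deckHom (M := Ball) hle
  haveI := isCancelSMul_range_deckHom (X := Ball) hle hfree
  haveI := locallyCompactSpace_orbitRelQuotient (Γ₁ := Γ₁) (M := Ball)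
  refine ⟨fun γ => contMDiff_ballDeckHom Γ₁ Γ hle γ, fun q => stabilizer_deck_eq_bot Γ₁ Γ hle hfree q,
    natCard_range_deckHom_eq Γ₁ Γ hle (hfree x₀), fun z => ?_, ?_, contMDiff_stagesHomeomorph_symm (actsBy_ball Γ) hle hfree⟩
  · rw [stagesHomeomorph_apply, stagesMap_mk, orbitMap_mk]
  · exact (contMDiff_stagesMap (actsBy_ball Γ) hle hfree).congr fun q => stagesHomeomorph_apply Γ₁ Γ hle q

end HodgeCM.PerL34.BallComplex

/-! ## §5  PerL v5 ll. 72–75: `P^L_{Γ_1} → P^L_Γ` is a finite GALOIS holomorphic covering -/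

namespace HodgeCM.PerL34.ArchCompactK

section PerLBall

open HodgeCM.PerL34.Godement HodgeCM.PerL34.Godement.Stages HodgeCM.PerL34.AdelicUnitaryFactorisation
open HodgeCM.PerL34.BallComplex HodgeCM.PerL34.QuotientManifold
open Literature.AlgebraicGeometry.ShimuraVarieties (signatureMatrix)
open HodgeCM.PerL34.BallModel (U21 Ball x₀)
open NumberField

variable (L : CMField) {ι₁ : L →+* ℂ} (V : HermSpace3 L ι₁) {T : GL (Fin 3) ℂ}
  (hT : (T : Matrix (Fin 3) (Fin 3) ℂ)ᴴ * V.Hm.map (InfinitePlace.mk ι₁).embedding *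
    (T : Matrix (Fin 3) (Fin 3) ℂ) = signatureMatrix 2)

include hT

/-- For discrete `Γ₁ ⊴ Γ ≤ G_U(ℝ)` of finite index with `Γ` free on `G_U(ℝ)/K_∞`: the images `Γ₁' ⊴ Γ' ≤ U(2,1)`
satisfy the Galois data `IsHolGalois`, and `[Γ' : Γ₁'] = [Γ : Γ₁]`. -/
theorem isHolGalois_ballOrbitMap (Γ₁ Γ : Subgroup (Uinf L V.Hm)) [DiscreteTopology Γ₁] [DiscreteTopology Γ]
    (hle : Γ₁ ≤ Γ) (hN : (Γ₁.subgroupOf Γ).Normal) (hFI : (Γ₁.subgroupOf Γ).FiniteIndex)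
    (hfree : ∀ q : Uinf L V.Hm ⧸ V.archK T, MulAction.stabilizer (Uinf L V.Hm) q ⊓ Γ = ⊥) :
    IsHolGalois (Γ₁.map (V.archToU21 hT)) (Γ.map (V.archToU21 hT))
      (HodgeCM.HermSpace3.discreteTopology_map_archToU21 V hT Γ₁)
      (isCancelSMul_of_stabilizer_inf_eq_bot _ (stabilizer_ball_eq_bot L V hT Γ₁ fun q =>
        eq_bot_iff.mpr (le_trans (inf_le_inf_left _ hle) (hfree q).le)))
      (HodgeCM.HermSpace3.discreteTopology_map_archToU21 V hT Γ)
      (isCancelSMul_of_stabilizer_inf_eq_bot _ (stabilizer_ball_eq_bot L V hT Γ hfree))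
      (Subgroup.map_mono hle) (@normal_subgroupOf_map _ _ _ _ (V.archToU21 hT) Γ₁ Γ hle hN)
      (@finiteIndex_subgroupOf_map _ _ _ _ (V.archToU21 hT) Γ₁ Γ hle hFI) ∧
    (Γ₁.map (V.archToU21 hT)).relIndex (Γ.map (V.archToU21 hT)) = Γ₁.relIndex Γ :=
  by
  haveI := HodgeCM.HermSpace3.discreteTopology_map_archToU21 V hT Γ₁
  haveI := HodgeCM.HermSpace3.discreteTopology_map_archToU21 V hT Γ
  haveI := isCancelSMul_of_stabilizer_inf_eq_bot _ (stabilizer_ball_eq_bot L V hT Γ hfree)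
  haveI := isCancelSMul_of_stabilizer_inf_eq_bot _ (stabilizer_ball_eq_bot L V hT Γ₁ fun q =>
    eq_bot_iff.mpr (le_trans (inf_le_inf_left _ hle) (hfree q).le))
  haveI := @normal_subgroupOf_map _ _ _ _ (V.archToU21 hT) Γ₁ Γ hle hN
  haveI := @finiteIndex_subgroupOf_map _ _ _ _ (V.archToU21 hT) Γ₁ Γ hle hFI
  refine ⟨?_, relIndex_map_eq (V.archToU21 hT) Γ₁ Γ hle (inf_ker_archToU21_eq_bot L V hT Γ hfree)⟩
  exact isHolGalois _ _ (Subgroup.map_mono hle)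

/-- **The Galois ball-piece record** of `K₁ ≤ K_f` at `b ∈ G_U(𝔸_f)` (all instance facts explicit): writing
`Γ₁ = Γ_H(bK₁b⁻¹)`, `Γ = Γ_H(bK_fb⁻¹) ≤ G_U(ℝ)` and `Γ₁', Γ' ≤ U(2,1)` for their images under `archToU21`,
(o) pv10-g4's `BallPieceCovering` (`Γ₁ ≤ Γ`, `[Γ:Γ₁] ∣ [K_f:K₁]`, `Γ₁'\𝔹² → Γ'\𝔹²` a covering map with all fibres
of cardinality `[Γ:Γ₁]`); (i) `Γ₁ ⊴ Γ` is normal of finite index; (ii) `Γ₁'\𝔹² → Γ'\𝔹²` is a holomorphic local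
biholomorphism (`IsHolEtale`); (iii) it is GALOIS (`IsHolGalois`: deck group `D ≅ Γ'/Γ₁'` of order `[Γ':Γ₁']`
acting freely by biholomorphisms on `Γ₁'\𝔹²`, and `(Γ₁'\𝔹²)/D → Γ'\𝔹²`, `[[z]] ↦ [z]`, a biholomorphism);
(iv) `[Γ' : Γ₁'] = [Γ : Γ₁]`. -/
def BallPieceGalois (K₁ Kf : Subgroup (Ufin L V.Hm)) (hK1c : IsCompact (K₁ : Set (Ufin L V.Hm)))
    (hK13 : K₁ ≤ levelUfin L V.Hm 3) (hKc : IsCompact (Kf : Set (Ufin L V.Hm))) (hK3 : Kf ≤ levelUfin L V.Hm 3)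
    (b : Ufin L V.Hm) : Prop :=
  BallPieceCovering L V hT K₁ Kf b ∧
    ∃ hle : congruenceLattice L V.Hm (MulAut.conj b • K₁) ≤ congruenceLattice L V.Hm (MulAut.conj b • Kf),
    ∃ hN : ((congruenceLattice L V.Hm (MulAut.conj b • K₁)).subgroupOf
        (congruenceLattice L V.Hm (MulAut.conj b • Kf))).Normal,
    ∃ hFI : ((congruenceLattice L V.Hm (MulAut.conj b • K₁)).subgroupOf
        (congruenceLattice L V.Hm (MulAut.conj b • Kf))).FiniteIndex,
      IsHolEtale ((congruenceLattice L V.Hm (MulAut.conj b • K₁)).map (V.archToU21 hT))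
        ((congruenceLattice L V.Hm (MulAut.conj b • Kf)).map (V.archToU21 hT))
        (discreteTopology_pieceLattice L V hT K₁ hK1c b) (isCancelSMul_pieceLattice L V hT K₁ hK1c hK13 b)
        (discreteTopology_pieceLattice L V hT Kf hKc b) (isCancelSMul_pieceLattice L V hT Kf hKc hK3 b)
        (orbitMap _ _ (Subgroup.map_mono hle) (X := Ball)) ∧
      IsHolGalois ((congruenceLattice L V.Hm (MulAut.conj b • K₁)).map (V.archToU21 hT))
        ((congruenceLattice L V.Hm (MulAut.conj b • Kf)).map (V.archToU21 hT))
        (discreteTopology_pieceLattice L V hT K₁ hK1c b) (isCancelSMul_pieceLattice L V hT K₁ hK1c hK13 b)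
        (discreteTopology_pieceLattice L V hT Kf hKc b) (isCancelSMul_pieceLattice L V hT Kf hKc hK3 b)
        (Subgroup.map_mono hle) (@normal_subgroupOf_map _ _ _ _ (V.archToU21 hT) _ _ hle hN)
        (@finiteIndex_subgroupOf_map _ _ _ _ (V.archToU21 hT) _ _ hle hFI) ∧
      ((congruenceLattice L V.Hm (MulAut.conj b • K₁)).map (V.archToU21 hT)).relIndex
          ((congruenceLattice L V.Hm (MulAut.conj b • Kf)).map (V.archToU21 hT)) =
        (congruenceLattice L V.Hm (MulAut.conj b • K₁)).relIndex (congruenceLattice L V.Hm (MulAut.conj b • Kf))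

/-- One piece: `Γ_H(bK₁b⁻¹) ⊴ Γ_H(bK_fb⁻¹)` normal of finite index dividing `[K_f : K₁]` (compact `K₁, K_f ≤ K_H(3)`)
gives the Galois ball-piece record at `b`. -/
theorem ballPieceGalois_of_normal (K₁ Kf : Subgroup (Ufin L V.Hm)) (hK1c : IsCompact (K₁ : Set (Ufin L V.Hm)))
    (hK13 : K₁ ≤ levelUfin L V.Hm 3) (hKc : IsCompact (Kf : Set (Ufin L V.Hm))) (hK3 : Kf ≤ levelUfin L V.Hm 3)
    (b : Ufin L V.Hm)
    (hle : congruenceLattice L V.Hm (MulAut.conj b • K₁) ≤ congruenceLattice L V.Hm (MulAut.conj b • Kf))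
    (hN : ((congruenceLattice L V.Hm (MulAut.conj b • K₁)).subgroupOf
        (congruenceLattice L V.Hm (MulAut.conj b • Kf))).Normal)
    (hFI : ((congruenceLattice L V.Hm (MulAut.conj b • K₁)).subgroupOf
        (congruenceLattice L V.Hm (MulAut.conj b • Kf))).FiniteIndex)
    (hdvd : (congruenceLattice L V.Hm (MulAut.conj b • K₁)).relIndex
        (congruenceLattice L V.Hm (MulAut.conj b • Kf)) ∣ K₁.relIndex Kf) :
    BallPieceGalois L V hT K₁ Kf hK1c hK13 hKc hK3 b := by
  haveI : DiscreteTopology (congruenceLattice L V.Hm (MulAut.conj b • K₁)) :=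
    HodgeCM.HermSpace3.discreteTopology_congruenceLattice L V _ (isCompact_conj_smul K₁ hK1c b)
  haveI : DiscreteTopology (congruenceLattice L V.Hm (MulAut.conj b • Kf)) :=
    HodgeCM.HermSpace3.discreteTopology_congruenceLattice L V _ (isCompact_conj_smul Kf hKc b)
  have hfree : ∀ q : Uinf L V.Hm ⧸ V.archK T,
      MulAction.stabilizer (Uinf L V.Hm) q ⊓ congruenceLattice L V.Hm (MulAut.conj b • Kf) = ⊥ := fun q =>
    stabilizer_inf_eq_bot_of_torsionFree _ (torsionFree_congruenceLattice_conj L le_rfl hK3 b) (V.archK T)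
      (V.isCompact_archK T) q
  have hcov : BallPieceCovering L V hT K₁ Kf b :=
    { le := hle
      relIndex_dvd := hdvd
      isCoveringMap := isCoveringMap_ballOrbitMap L V hT _ _ hle hN hFI hfree
      natCard_fiber := natCard_fiber_ballOrbitMap L V hT _ _ hle hN hFI hfree }
  exact ⟨hcov, hle, hN, hFI, isHolEtale_ballOrbitMap L V hT _ _ hle hfree,
    isHolGalois_ballOrbitMap L V hT _ _ hle hN hFI hfree⟩

/-- **PerL v5 §1.2 ll. 72–75 ON THE BALL, complex-analytically, GALOIS form (KERNEL).**  For a hermitian 3-space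
`V` over the CM field `L`, a Sylvester frame `T` at `ι₁` and a compact open level `K_f ≤ K_H(3)`: there is a compact
open `K₁ ≤ K_f`, `K₁ ≤ K_H(3)`, NORMAL of FINITE INDEX in `K_f`, such that for EVERY `b ∈ G_U(𝔸_f)` the Galois
ball-piece record `BallPieceGalois` holds: with `Γ₁ = Γ_H(bK₁b⁻¹) ⊴ Γ = Γ_H(bK_fb⁻¹)` (normal of finite index
`[Γ:Γ₁] ∣ [K_f:K₁]`) and `Γ₁', Γ' ≤ U(2,1)` their images, the map of complex surfaces `Γ₁'\𝔹² → Γ'\𝔹²` is a covering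
map with all fibres of cardinality `[Γ:Γ₁]`, a holomorphic local biholomorphism, and GALOIS — the deck group
`D ≅ Γ'/Γ₁'`, of order `[Γ':Γ₁'] = [Γ:Γ₁]`, acts freely on `Γ₁'\𝔹²` by biholomorphisms and `(Γ₁'\𝔹²)/D → Γ'\𝔹²` is a
biholomorphism.  This is "`P^L_{Γ_1} → P^L_Γ` finite étale, Galois with group `Γ/Γ_1`" in the complex-analytic
category.  NOT claimed: algebraicity / projectivity of `Γ\𝔹²` (PRINT: Baily–Borel / Kodaira), nor étaleness in the
sense of schemes. -/
theorem _root_.HodgeCM.HermSpace3.exists_ballPieces_galoisCovering (Kf : Subgroup (Ufin L V.Hm))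
    (hKo : IsOpen (Kf : Set (Ufin L V.Hm))) (hKc : IsCompact (Kf : Set (Ufin L V.Hm)))
    (hK3 : Kf ≤ levelUfin L V.Hm 3) :
    ∃ K₁ : Subgroup (Ufin L V.Hm), ∃ hK1c : IsCompact (K₁ : Set (Ufin L V.Hm)), ∃ hK13 : K₁ ≤ levelUfin L V.Hm 3,
      K₁ ≤ Kf ∧ IsOpen (K₁ : Set (Ufin L V.Hm)) ∧ (K₁.subgroupOf Kf).Normal ∧ (K₁.subgroupOf Kf).FiniteIndex ∧
      ∀ b : Ufin L V.Hm, BallPieceGalois L V hT K₁ Kf hK1c hK13 hKc hK3 b := by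
  obtain ⟨K₁, h1f, h13, hK1o, hK1c, hN, hFI, hg⟩ :=
    HodgeCM.PerL34.Godement.exists_torsionFree_normal_tower L V.Hm Kf hKo hKc
  exact ⟨K₁, hK1c, h13, h1f, hK1o, hN, hFI, fun b =>
    ballPieceGalois_of_normal L V hT K₁ Kf hK1c h13 hKc hK3 b (hg b).1 (hg b).2.1 (hg b).2.2.1 (hg b).2.2.2.1⟩

end PerLBall

end HodgeCM.PerL34.ArchCompactK

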